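import Literature.MeasureTheory.Hausdorff.CylinderHausdorffProduct
import Mathlib.MeasureTheory.Measure.WithDensity
import Mathlib.MeasureTheory.Measure.Lebesgue.EqHaar
import HarnessLib

/-!
# The Hausdorff measure of the round cylinder of radius `r`, and integrals over it

From `μHE[n]⌊{‖P_V z‖ = 1} = f_* (μHE[k]⌊S_V(1) ⊗ vol_{Vᗮ})` (`CylinderHausdorffProduct.lean`)
we derive the same identity for every radius `r > 0`
(`euclideanHausdorff_restrict_cylinder_eq_productMeasure_radius`), by transporting both sides
along the dilation `z ↦ r z`: `μHE[n]` scales by `r^n`, `μHE[k]⌊S_V` by `r^k` and `vol_{Vᗮ}` by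
`r^{n-k}` (`restrict_cylinder_eq_smul_map_smul`, `restrict_sphere_prod_eq_smul_map_smul`).
Consequences: Fubini for `ℝ≥0∞`-valued functions on the cylinder
(`lintegral_cylinder_eq_lintegral_prod`) and the product rule
`∫⁻_{Cyl_r} g (P_V z) h (P_{Vᗮ} z) = (∫⁻_{S_V(r)} g dμHE[k]) (∫⁻_{Vᗮ} h dvol)`
(`lintegral_cylinder_mul`), which is the "simple computation" behind
`λ(Σ × ℝ) = λ(Σ)` for `Σ = S^k` (Colding–Ilmanen–Minicozzi–White 2013, Introduction).
Support for `Literature.Geometry.Riemannian.Stone1994_cylinderEntropy`.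

## References

* T. H. Colding, T. Ilmanen, W. P. Minicozzi II, B. White, *The round sphere minimizes entropy
  among closed self-shrinkers*, J. Differential Geom. 95 (2013), Introduction.
* H. Federer, *Geometric measure theory* (1969), 2.10.11, 3.2.23.
-/

noncomputable section

open Set Metric Module Submodule Filter Function
open _root_.MeasureTheory _root_.MeasureTheory.Measure
open scoped ENNReal NNReal Topology RealInnerProductSpace Pointwise

namespace Literature.MeasureTheory.Hausdorff

variable {E : Type*} [NormedAddCommGroup E] [InnerProductSpace ℝ E] [FiniteDimensional ℝ E]
  [MeasurableSpace E] [BorelSpace E] (V : Submodule ℝ E)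

/-- `(‖r‖₊ : ℝ≥0∞) ^ d = ENNReal.ofReal (r ^ d)` for `r ≥ 0`. [folklore] -/
theorem coe_nnnorm_pow_eq_ofReal_pow {r : ℝ} (hr : 0 ≤ r) (d : ℕ) :
    ((‖r‖₊ ^ d : ℝ≥0) : ℝ≥0∞) = ENNReal.ofReal (r ^ d) := by
  rw [ENNReal.coe_pow, ← ENNReal.ofReal_coe_nnreal, coe_nnnorm, Real.norm_eq_abs, abs_of_nonneg hr,
    ENNReal.ofReal_pow hr]

/-- **Scaling of the Hausdorff measure of the cylinder**: for `r > 0`,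
`μHE[n]⌊{‖P_V z‖ = r} = r^n • (z ↦ r z)_* (μHE[n]⌊{‖P_V z‖ = 1})`. [folklore] -/
theorem restrict_cylinder_eq_smul_map_smul (n : ℕ) {r : ℝ} (hr : 0 < r) :
    (μHE[n] : Measure E).restrict {z : E | ‖V.orthogonalProjectionOnto z‖ = r} =
      ENNReal.ofReal (r ^ n) • Measure.map (fun z : E ↦ r • z)
        ((μHE[n] : Measure E).restrict {z : E | ‖V.orthogonalProjectionOnto z‖ = 1}) := by
  have hD : Measurable (fun z : E ↦ r • z) := by fun_prop
  have hpre : (fun z : E ↦ r • z) ⁻¹' {z : E | ‖V.orthogonalProjectionOnto z‖ = r} =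
      {z : E | ‖V.orthogonalProjectionOnto z‖ = 1} := by
    ext z
    simp only [mem_preimage, mem_setOf_eq, map_smul, norm_smul, Real.norm_eq_abs, abs_of_pos hr]
    constructor
    · intro h; exact mul_left_cancel₀ hr.ne' (by rw [h, mul_one])
    · intro h; rw [h, mul_one]
  ext T hT
  rw [Measure.restrict_apply hT, Measure.smul_apply, Measure.map_apply hD hT,
    Measure.restrict_apply (hD hT), ← hpre, ← Set.preimage_inter, Set.preimage_smul₀ hr.ne',
    Measure.euclideanHausdorffMeasure_smul₀ n (inv_ne_zero hr.ne'), smul_eq_mul, ENNReal.smul_def,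
    smul_eq_mul, ← mul_assoc, nnnorm_inv, inv_pow, ENNReal.coe_inv (pow_ne_zero _ (by simpa using hr.ne')),
    coe_nnnorm_pow_eq_ofReal_pow hr.le, ENNReal.mul_inv_cancel (by simpa using pow_pos hr n) ENNReal.ofReal_ne_top,
    one_mul]

/-- **Scaling of the product measure**: for `r > 0` and `dim Vᗮ = m`,
`μHE[k]⌊S_V(r) ⊗ vol = r^{k+m} • (r ·, r ·)_* (μHE[k]⌊S_V(1) ⊗ vol)`. [folklore] -/
theorem restrict_sphere_prod_eq_smul_map_smul (k : ℕ) {m : ℕ} (hm : finrank ℝ Vᗮ = m) {r : ℝ}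
    (hr : 0 < r) [SFinite ((μHE[k] : Measure V).restrict (sphere 0 1))]
    [SFinite ((μHE[k] : Measure V).restrict (sphere 0 r))] :
    ((μHE[k] : Measure V).restrict (sphere 0 r)).prod (volume : Measure Vᗮ) =
      ENNReal.ofReal (r ^ (k + m)) • Measure.map (Prod.map (fun a : V ↦ r • a) (fun b : Vᗮ ↦ r • b))
        (((μHE[k] : Measure V).restrict (sphere 0 1)).prod (volume : Measure Vᗮ)) := by
  have hDV : Measurable (fun a : V ↦ r • a) := by fun_prop
  have hDW : Measurable (fun b : Vᗮ ↦ r • b) := by fun_prop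
  -- the sphere factor
  have h1 : (μHE[k] : Measure V).restrict (sphere 0 r) =
      ENNReal.ofReal (r ^ k) • Measure.map (fun a : V ↦ r • a) ((μHE[k] : Measure V).restrict (sphere 0 1)) := by
    have hpre : (fun a : V ↦ r • a) ⁻¹' sphere (0 : V) r = sphere 0 1 := by
      ext a
      simp only [mem_preimage, mem_sphere_zero_iff_norm, norm_smul, Real.norm_eq_abs, abs_of_pos hr]
      constructor
      · intro h; exact mul_left_cancel₀ hr.ne' (by rw [h, mul_one])
      · intro h; rw [h, mul_one]
    ext B hB
    rw [Measure.restrict_apply hB, Measure.smul_apply, Measure.map_apply hDV hB,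
      Measure.restrict_apply (hDV hB), ← hpre, ← Set.preimage_inter, Set.preimage_smul₀ hr.ne',
      Measure.euclideanHausdorffMeasure_smul₀ k (inv_ne_zero hr.ne'), smul_eq_mul, ENNReal.smul_def,
      smul_eq_mul, ← mul_assoc, nnnorm_inv, inv_pow, ENNReal.coe_inv (pow_ne_zero _ (by simpa using hr.ne')),
      coe_nnnorm_pow_eq_ofReal_pow hr.le, ENNReal.mul_inv_cancel (by simpa using pow_pos hr k) ENNReal.ofReal_ne_top,
      one_mul]
  -- the Lebesgue factor
  have h2 : (volume : Measure Vᗮ) = ENNReal.ofReal (r ^ m) • Measure.map (fun b : Vᗮ ↦ r • b) volume := by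
    rw [Measure.map_addHaar_smul volume hr.ne', hm, smul_smul, ← ENNReal.ofReal_mul (pow_nonneg hr.le _),
      abs_of_pos (inv_pos.2 (pow_pos hr m)), mul_inv_cancel₀ (pow_ne_zero _ hr.ne'), ENNReal.ofReal_one,
      one_smul]
  rw [h1, Measure.prod_smul_left]
  conv_lhs => rw [h2]
  rw [Measure.prod_smul_right, Measure.map_prod_map _ _ hDV hDW, smul_smul, ← ENNReal.ofReal_mul
    (pow_nonneg hr.le _), ← pow_add]

/-- **The Hausdorff measure of the round cylinder of radius `r` is the product measure.** For a
real inner product space `E` of dimension `n + 1`, a subspace `V` of dimension `k + 1` (`k ≥ 1`)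
and `r > 0`: `μHE[n]⌊{‖P_V z‖ = r} = f_* (μHE[k]⌊S_V(r) ⊗ vol_{Vᗮ})`, `f (a, b) = a + b`.
[folklore] -/
theorem euclideanHausdorff_restrict_cylinder_eq_productMeasure_radius {n k : ℕ}
    (hE : finrank ℝ E = n + 1) (hV : finrank ℝ V = k + 1) (hk : 0 < k) {r : ℝ} (hr : 0 < r) :
    (μHE[n] : Measure E).restrict {z : E | ‖V.orthogonalProjectionOnto z‖ = r} =
      Measure.map (fun p : V × Vᗮ ↦ (p.1 : E) + (p.2 : E))
        (((μHE[k] : Measure V).restrict (sphere 0 r)).prod (volume : Measure Vᗮ)) := by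
  haveI : IsFiniteMeasure ((μHE[k] : Measure V).restrict (sphere 0 1)) :=
    ⟨by rw [Measure.restrict_apply_univ]; exact euclideanHausdorffMeasure_sphere_lt_top hV 1⟩
  haveI : IsFiniteMeasure ((μHE[k] : Measure V).restrict (sphere 0 r)) :=
    ⟨by rw [Measure.restrict_apply_univ]; exact euclideanHausdorffMeasure_sphere_lt_top hV r⟩
  obtain ⟨m, hm⟩ : ∃ m : ℕ, finrank ℝ Vᗮ = m := ⟨_, rfl⟩
  have hnm : k + m = n := by
    have := Submodule.finrank_add_finrank_orthogonal V
    omega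
  have hf : Measurable (fun p : V × Vᗮ ↦ (p.1 : E) + (p.2 : E)) := by fun_prop
  have hD : Measurable (fun z : E ↦ r • z) := by fun_prop
  have hDD : Measurable (Prod.map (fun a : V ↦ r • a) (fun b : Vᗮ ↦ r • b)) := by fun_prop
  have hcomm : (fun z : E ↦ r • z) ∘ (fun p : V × Vᗮ ↦ (p.1 : E) + (p.2 : E)) =
      (fun p : V × Vᗮ ↦ (p.1 : E) + (p.2 : E)) ∘ Prod.map (fun a : V ↦ r • a) (fun b : Vᗮ ↦ r • b) := by
    funext p
    simp [smul_add]
  rw [restrict_cylinder_eq_smul_map_smul V n hr,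
    euclideanHausdorff_restrict_cylinder_eq_productMeasure V hE hV hk,
    Measure.map_map hD hf, hcomm, ← Measure.map_map hf hDD, ← Measure.map_smul, ← hnm,
    ← restrict_sphere_prod_eq_smul_map_smul V k hm hr]

/-- **Fubini on the round cylinder** (`ℝ≥0∞`-valued): for measurable `F` and `r > 0`,
`∫⁻_{‖P_V z‖ = r} F dμHE[n] = ∫⁻_{S_V(r) × Vᗮ} F (a + b) d(μHE[k] ⊗ vol)`. [folklore] -/
theorem lintegral_cylinder_eq_lintegral_prod {n k : ℕ} (hE : finrank ℝ E = n + 1)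
    (hV : finrank ℝ V = k + 1) (hk : 0 < k) {r : ℝ} (hr : 0 < r) {F : E → ℝ≥0∞}
    (hF : Measurable F) :
    ∫⁻ z in {z : E | ‖V.orthogonalProjectionOnto z‖ = r}, F z ∂(μHE[n] : Measure E) =
      ∫⁻ p : V × Vᗮ, F ((p.1 : E) + (p.2 : E))
        ∂(((μHE[k] : Measure V).restrict (sphere 0 r)).prod (volume : Measure Vᗮ)) := by
  rw [euclideanHausdorff_restrict_cylinder_eq_productMeasure_radius V hE hV hk hr,
    lintegral_map hF (by fun_prop)]

/-- **`λ(S^k × ℝ^{n-k})`-type product rule**: for measurable `g : V → ℝ≥0∞`, `h : Vᗮ → ℝ≥0∞` and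
`r > 0`, `∫⁻_{‖P_V z‖ = r} g (P_V z) h (P_{Vᗮ} z) dμHE[n] = (∫⁻_{S_V(r)} g dμHE[k]) (∫⁻ h dvol)`
(the "simple computation" behind `λ(Σ × ℝ) = λ(Σ)`, Colding–Ilmanen–Minicozzi–White 2013,
Introduction, for `Σ = S^k`). [cite: ColdingIlmanenMinicozziWhite2013, Introduction] -/
theorem lintegral_cylinder_mul {n k : ℕ} (hE : finrank ℝ E = n + 1) (hV : finrank ℝ V = k + 1)
    (hk : 0 < k) {r : ℝ} (hr : 0 < r) {g : V → ℝ≥0∞} {h : Vᗮ → ℝ≥0∞} (hg : Measurable g)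
    (hh : Measurable h) :
    ∫⁻ z in {z : E | ‖V.orthogonalProjectionOnto z‖ = r},
        g (V.orthogonalProjectionOnto z) * h (Vᗮ.orthogonalProjectionOnto z) ∂(μHE[n] : Measure E) =
      (∫⁻ a in sphere (0 : V) r, g a ∂(μHE[k] : Measure V)) * ∫⁻ b, h b ∂(volume : Measure Vᗮ) := by
  haveI : IsFiniteMeasure ((μHE[k] : Measure V).restrict (sphere 0 r)) :=
    ⟨by rw [Measure.restrict_apply_univ]; exact euclideanHausdorffMeasure_sphere_lt_top hV r⟩
  have hF : Measurable fun z : E ↦ g (V.orthogonalProjectionOnto z) * h (Vᗮ.orthogonalProjectionOnto z) :=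
    (hg.comp V.orthogonalProjectionOnto.continuous.measurable).mul
      (hh.comp Vᗮ.orthogonalProjectionOnto.continuous.measurable)
  rw [lintegral_cylinder_eq_lintegral_prod V hE hV hk hr hF]
  have hsimp : ∀ p : V × Vᗮ, g (V.orthogonalProjectionOnto ((p.1 : E) + (p.2 : E))) *
      h (Vᗮ.orthogonalProjectionOnto ((p.1 : E) + (p.2 : E))) = g p.1 * h p.2 := by
    intro p
    rw [map_add, map_add, orthogonalProjectionOnto_mem_subspace_eq_self,
      orthogonalProjectionOnto_apply_of_mem_orthogonal p.2.2, add_zero,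
      orthogonalProjectionOnto_orthogonal_apply_eq_zero p.1.2, zero_add,
      orthogonalProjectionOnto_mem_subspace_eq_self]
  simp_rw [hsimp]
  exact lintegral_prod_mul hg.aemeasurable hh.aemeasurable

end Literature.MeasureTheory.Hausdorff

end
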